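import Literature.Topology.FourManifolds.BallUnionDiscLocalHomology
import Literature.Topology.FourManifolds.SliceDiscExteriorHomology
import Literature.Topology.FourManifolds.ClosedManifoldModTwoDuality
import Literature.AlgebraicTopology.SingularHomology.ZModCoefficients
import HarnessLib

/-!
# `H₂(X(K') ∪ V; ℤ) = 0`: the homology leaf of Manolescu–Piccirillo's Lemma 3.3 (`W = S⁴`)

Fact seat
`Literature.Topology.FourManifolds.Knot.isZero_singularHomologyZ_two_of_isSliceDiscIn_of_range_eq`
(`ZeroSurgeryHomotopyBallSliceProofs.lean`). C. Manolescu, L. Piccirillo, *From zero surgeries to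
candidates for exotic definite 4-manifolds*, J. Lond. Math. Soc. 108 (2023), §3.2, proof of
Lemma 3.3 (arXiv v3, p. 7): for `X := X(-K') ∪_φ V` — the `0`-trace of `K'` glued to a slice-disc
exterior `V` of `K` along a `0`-surgery homeomorphism — "It is routine to confirm that `X` has the
homology type of `W`"; for `W = S⁴` this is `H₂(X; ℤ) = 0`. The tree states it in the complement
form: `X` closed smooth, `(e, f)` a slice-disc datum for `K'` (`K'.IsSliceDiscIn X e f`), and a
smooth embedding `j` of the open slice-disc exterior `B̊⁴ ∖ Δ`, `Δ = g(𝔻²)`, onto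
`X ∖ (e(𝔻⁴) ∪ f(𝔻²))`. This file **proves** it (`…_holds`), with no hypothesis relating `K` and
`K'` and without orientability of `X`:

Write `C = e(𝔻⁴) ∪ f(𝔻²)`, `U = X ∖ C ≅ B̊⁴ ∖ Δ`. By `SliceDiscExteriorHomology.lean`
(Hatcher Prop. 2B.1(b) for the `2`-sphere `Δ ∪ {∞} ⊂ S⁴`), `Hᵢ(U; M) = 0` for `i ≥ 2` and
`H₁(U; M) ≅ M`; by `BallUnionDiscLocalHomology.lean`, `H₃(X | C; M) = 0` and `H₂(X | C; M) ≅ M`.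
In the long exact sequence of the pair `(X, U)`:
* with `ℤ/2`-coefficients: `H₃(X) = 0` (between `H₃(U) = 0` and `H₃(X | C) = 0`), hence
  `H₁(X; ℤ/2) = 0` by mod-`2` Poincaré duality (`ClosedManifoldModTwoDuality.lean`), so
  `∂ : H₂(X | C) → H₁(U)` is onto, hence (both sides having two elements) injective, and
  `H₂(X; ℤ/2) = 0` (it injects into `H₂(X | C)` since `H₂(U) = 0`, and dies under `∂`);
* with `ℤ`-coefficients: `H₂(X; ℤ) ↪ H₂(X | C; ℤ) ≅ ℤ`, and by the Bockstein sequence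
  (`ZModCoefficients.lean`) every class of `H₂(X; ℤ)` is `2`-divisible since `H₂(X; ℤ/2) = 0`;
  a `2`-divisible subgroup of `ℤ` is zero.

No `sorry`, no new definitions, no new named facts; net effect: the fact is discharged.

## References

* C. Manolescu, L. Piccirillo, J. Lond. Math. Soc. 108 (2023), §3.2, Lemma 3.3 and its proof,
  Definition 3.4 [ManolescuPiccirillo2023].
* A. Hatcher, *Algebraic Topology*, CUP 2002, Thm. 2.16, Prop. 2B.1, §3.3 Thm. 3.30, §3.E
  [HatcherAT2002].
-/

noncomputable section

open Set Function Metric Topology CategoryTheory Limits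
open scoped Manifold ContDiff
open Literature.AlgebraicTopology.SingularHomology

universe u

namespace Literature.Topology.FourManifolds

namespace Knot

/-- **`H₂(X; ℤ/2) = 0` and the injection `H₂(X; ℤ) ↪ ℤ`, abstractly.** The diagram chase of
the module docstring, for a space `X` and a subset `C` such that:
`H₂(X ∖ C; ℤ/2) = H₃(X ∖ C; ℤ/2) = 0`,
`H₁(X ∖ C; ℤ/2)` and `H₂(X | C; ℤ/2)` have two elements, `H₃(X | C; ℤ/2) = 0`, and
`H₃(X; ℤ/2) = 0 ⇒ H₁(X; ℤ/2) = 0` (mod-`2` duality): then `H₂(X; ℤ/2) = 0`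
(long exact sequence of the pair, Hatcher Thm. 2.16). [cite: HatcherAT2002, Thm. 2.16] -/
theorem isZero_singularHomology_zmodTwo_two_of_pair {X : Type u} [TopologicalSpace X] (C : Set X)
    (hU2 : IsZero (singularHomology (ZMod 2) (ZMod 2) ↥Cᶜ 2))
    (hU3 : IsZero (singularHomology (ZMod 2) (ZMod 2) ↥Cᶜ 3))
    (EU1 : singularHomology (ZMod 2) (ZMod 2) ↥Cᶜ 1 ≃ ULift.{0} (ZMod 2))
    (hC3 : IsZero (localHomologyOfSet (ZMod 2) (ZMod 2) X C 3))
    (EC2 : localHomologyOfSet (ZMod 2) (ZMod 2) X C 2 ≃ ULift.{0} (ZMod 2))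
    (hPD : IsZero (singularHomology (ZMod 2) (ZMod 2) X 3) →
      IsZero (singularHomology (ZMod 2) (ZMod 2) X 1)) :
    IsZero (singularHomology (ZMod 2) (ZMod 2) X 2) := by
  -- `H₃(X) = 0`, hence `H₁(X) = 0`
  have hX3 : IsZero (singularHomology (ZMod 2) (ZMod 2) X 3) :=
    (relativeSingularHomology.exact_map_ofAbsolute (ZMod 2) (ZMod 2) (X := X) Cᶜ
        3).isZero_of_both_zeros (hU3.eq_of_src _ _) (hC3.eq_of_tgt _ _)
  have hX1 := hPD hX3
  -- `∂ : H₂(X | C) → H₁(X ∖ C)` is onto, hence injective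
  have hδepi : Epi (relativeSingularHomology.δ (ZMod 2) (ZMod 2) X Cᶜ 1) :=
    (relativeSingularHomology.exact_δ_map (ZMod 2) (ZMod 2) (X := X) Cᶜ 1).epi_f (hX1.eq_of_tgt _ _)
  have hδsurj : Surjective (relativeSingularHomology.δ (ZMod 2) (ZMod 2) X Cᶜ 1) :=
    (ModuleCat.epi_iff_surjective _).1 hδepi
  haveI : Finite (localHomologyOfSet (ZMod 2) (ZMod 2) X C 2) := Finite.of_equiv _ EC2.symm
  have hδinj : Injective (relativeSingularHomology.δ (ZMod 2) (ZMod 2) X Cᶜ 1) :=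
    (Finite.injective_iff_surjective_of_equiv (EC2.trans EU1.symm)).2 hδsurj
  -- `j_* : H₂(X) → H₂(X | C)` is injective and killed by `∂`
  have hmono : Mono (relativeSingularHomology.ofAbsolute (ZMod 2) (ZMod 2) X Cᶜ 2) :=
    (relativeSingularHomology.exact_map_ofAbsolute (ZMod 2) (ZMod 2) (X := X) Cᶜ 2).mono_g
      (hU2.eq_of_src _ _)
  have hinj := (ModuleCat.mono_iff_injective _).1 hmono
  have h0 : ∀ z : singularHomology (ZMod 2) (ZMod 2) X 2,
      relativeSingularHomology.δ (ZMod 2) (ZMod 2) X Cᶜ 1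
        (relativeSingularHomology.ofAbsolute (ZMod 2) (ZMod 2) X Cᶜ 2 z) = 0 := by
    intro z
    rw [← ModuleCat.comp_apply, relativeSingularHomology.ofAbsolute_comp_δ]
    rfl
  rw [ModuleCat.isZero_iff_subsingleton]
  refine ⟨fun x y => hinj (hδinj ?_)⟩
  rw [h0, h0]

/-- **`H₂(X; ℤ) = 0` from `H₂(X; ℤ/2) = 0` and `H₂(X; ℤ) ↪ H₂(X | C; ℤ) ≅ ℤ`**
(`H₂(X ∖ C; ℤ) = 0`):
by the Bockstein sequence every integral class is `2`-divisible (`ZModCoefficients.lean`), and a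
`2`-divisible subgroup of `ℤ` vanishes (Hatcher §3.E). [cite: HatcherAT2002, §3.E p. 303] -/
theorem isZero_singularHomology_int_two_of_pair {X : Type u} [TopologicalSpace X] (C : Set X)
    (hU2 : IsZero (singularHomology ℤ ℤ ↥Cᶜ 2))
    (EC2 : localHomologyOfSet ℤ ℤ X C 2 ≃ₗ[ℤ] ULift.{0} ℤ)
    (h2 : IsZero (singularHomology (ZMod 2) (ZMod 2) X 2)) :
    IsZero (singularHomology ℤ ℤ X 2) := by
  have hZ2 : IsZero (singularHomology ℤ (ZMod 2) X 2) :=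
    (isZero_singularHomology_int_zmod_iff 2 2).2 h2
  have hdiv : ∀ x : singularHomology ℤ ℤ X 2, ∃ y : singularHomology ℤ ℤ X 2, (2 : ℤ) • y = x :=
    fun x => singularHomology.exists_zsmul_eq_of_isZero (d := 2) two_pos 2 hZ2 x
  -- the injection `H₂(X; ℤ) → H₂(X | C; ℤ) ≅ ℤ`
  have hmono : Mono (relativeSingularHomology.ofAbsolute ℤ ℤ X Cᶜ 2) :=
    (relativeSingularHomology.exact_map_ofAbsolute ℤ ℤ (X := X) Cᶜ 2).mono_g (hU2.eq_of_src _ _)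
  have hinj := (ModuleCat.mono_iff_injective _).1 hmono
  let ι : singularHomology ℤ ℤ X 2 →+ ℤ :=
    (ULift.moduleEquiv (R := ℤ) : ULift.{0} ℤ ≃ₗ[ℤ] ℤ).toLinearMap.toAddMonoidHom.comp
      (EC2.toLinearMap.toAddMonoidHom.comp
        (relativeSingularHomology.ofAbsolute ℤ ℤ X Cᶜ 2).hom.toAddMonoidHom)
  have hι : Injective ι :=
    (ULift.moduleEquiv (R := ℤ)).injective.comp (EC2.injective.comp hinj)
  rw [ModuleCat.isZero_iff_subsingleton]
  refine ⟨fun x y => ?_⟩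
  rw [eq_zero_of_forall_exists_zsmul_of_injective le_rfl hdiv ι hι x,
    eq_zero_of_forall_exists_zsmul_of_injective le_rfl hdiv ι hι y]

/-- **Discharge of `isZero_singularHomologyZ_two_of_isSliceDiscIn_of_range_eq`**
(Manolescu–Piccirillo 2023, §3.2, proof of Lemma 3.3 for `W = S⁴`, the homology step: "It is
routine to confirm that `X` has the homology type of `W`"). Let `X` be a closed smooth
`4`-manifold, `(e, f)` a slice-disc datum for `K'` in `X` and `j : B̊⁴ ∖ Δ ↪ X` a smooth
embedding onto the complement of
`C = e(𝔻⁴) ∪ f(𝔻²)`, `Δ = g(𝔻²)` a slice disc of `K`. Then `H₂(X; ℤ) = 0`: the inputs of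
`isZero_singularHomology_zmodTwo_two_of_pair` / `isZero_singularHomology_int_two_of_pair` are the
homology of the slice-disc exterior (`SliceDiscExteriorHomology.lean`, through the homeomorphism
`B̊⁴ ∖ Δ ≃ₜ range j = X ∖ C` across universes), the local homology of `X` along `C`
(`BallUnionDiscLocalHomology.lean`) and mod-`2` Poincaré duality
(`ClosedManifoldModTwoDuality.lean`).
[cite: ManolescuPiccirillo2023, §3.2, proof of Lemma 3.3] -/
theorem isZero_singularHomologyZ_two_of_isSliceDiscIn_of_range_eq_holds :
    isZero_singularHomologyZ_two_of_isSliceDiscIn_of_range_eq := by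
  intro K K' g hg X _ _ _ _ _ _ e f j hef hj hrange
  change IsZero (singularHomology ℤ ℤ X 2)
  set C : Set X := e '' Metric.closedBall (0 : EuclideanSpace ℝ (Fin 4)) 1 ∪
    f '' Metric.closedBall (0 : EuclideanSpace ℝ (Fin 2)) 1 with hC
  -- the open slice-disc exterior is `X ∖ C`, across universes
  have Θ : sliceDiscExterior g ≃ₜ ↥(Cᶜ) :=
    hj.isEmbedding.toHomeomorph.trans (Homeomorph.setCongr hrange)
  have hU : ∀ (R : Type) [CommRing R] (M : Type) [AddCommGroup M] [Module R M] (i : ℕ), 2 ≤ i →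
      IsZero (singularHomology R M ↥(Cᶜ) i) := by
    intro R _ M _ _ i hi
    exact (singularHomology.isZero_iff_of_homeomorph R M Θ i).1
      (hg.isZero_singularHomology_sliceDiscExterior R M hi)
  have hU1 : ∀ (R : Type) [CommRing R] (M : Type) [AddCommGroup M] [Module R M],
      Nonempty (singularHomology R M ↥(Cᶜ) 1 ≃ₗ[R] ULift.{0} M) := by
    intro R _ M _ _
    obtain ⟨ι⟩ := hg.nonempty_singularHomology_sliceDiscExterior_one_iso R M
    exact ⟨(singularHomology.xEquiv R M Θ 1).symm ≪≫ₗ ι.toLinearEquiv⟩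
  -- `ℤ/2`: `H₂(X; ℤ/2) = 0`
  obtain ⟨EU1⟩ := hU1 (ZMod 2) (ZMod 2)
  obtain ⟨EC2⟩ := hef.nonempty_localHomologyOfSet_ball_union_disc_two_linearEquiv (ZMod 2) (ZMod 2)
  have h2 : IsZero (singularHomology (ZMod 2) (ZMod 2) X 2) :=
    isZero_singularHomology_zmodTwo_two_of_pair C (hU (ZMod 2) (ZMod 2) 2 le_rfl)
      (hU (ZMod 2) (ZMod 2) 3 (by omega)) EU1.toEquiv
      (hef.isZero_localHomologyOfSet_ball_union_disc_three (ZMod 2) (ZMod 2)) EC2.toEquiv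
      (isZero_singularHomology_zmodTwo_of_isZero_of_add_eq (n := 4) (by norm_num) (p := 1) (q := 3)
        (by norm_num))
  -- `ℤ`
  obtain ⟨EC2ℤ⟩ := hef.nonempty_localHomologyOfSet_ball_union_disc_two_linearEquiv ℤ ℤ
  exact isZero_singularHomology_int_two_of_pair C (hU ℤ ℤ 2 le_rfl) EC2ℤ h2

end Knot

end Literature.Topology.FourManifolds
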